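import Summits.CriticalPhenomena.PercolationContinuityZ3.Theorems.PercNearOneGluingNoHeavyLowerTailForestRayleighContractSteps
import HarnessLib

/-!
# Weighted forest negative correlation — contraction III: an instance with a pinned edge reduces to the contracted graph

Notation as in `…ForestRayleighTools`; `(R)(D;K;e,f)` the Rayleigh inequality; "`R₀` has the Rayleigh
property" written out.

**Theorem (`lsm_of_pinned_contract`).** Let `R₀ ⊆ Sym2 V` have the Rayleigh property and `u ≠ v`.
Every loop-free instance `(D;K;e,f)` (any activities `w ≥ 0`) with `uv ∈ K` pinned, all of whose
edges avoiding `v` lie in `R₀`, and with `ux ∈ R₀` whenever `vx` is an edge of the instance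
(`x ≠ u`), satisfies `(R)`. In words: **pinned instances of a graph reduce to instances of its
contraction** `E/uv` realised inside `R₀` on the vertices `≠ v`. Proof: induction on the number of
edges at `v`; an edge `vx` (`x ≠ u`) is removed according to the position of `vx` and of its
parallel partner `ux` (`…ContractSteps`: merge / re-route / drop / cancel against a Rayleigh edge, or
`(R)` is trivial because `K ∪ {e,f}` contains the triangle `uvx`); when only `uv` is left at `v` it
is a pinned pendant edge and the instance lives in `R₀`. With the top cells (`…FiveTop*`) and
deletion this reduces the Rayleigh property of a graph to that of its proper minors.
Theorems only; no definitions, no `sorry`.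
-/

open Finset SimpleGraph
open scoped Classical

namespace Summit.CriticalPhenomena.PercolationContinuityZ3.Theorems.ForestRayleigh

variable {V : Type*} [Fintype V] [DecidableEq V]

omit [Fintype V] in
/-- Bookkeeping for one contraction step: the structural hypotheses pass from the instance edge set
`E` to `E' ⊆ E ∪ g'` when the edge `g ∋ v` of `E` disappears and the new edge `g' ∌ v` lies in `R₀`.
[elementary] -/
theorem contract_transfer {E E' R₀ : Finset (Sym2 V)} {g g' : Sym2 V} {u v : V} {n : ℕ}
    (hsub : E' ⊆ insert g' E) (hg'R : g' ∈ R₀) (hg'd : ¬g'.IsDiag) (hvg' : v ∉ g')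
    (hgE : g ∈ E) (hgE' : g ∉ E') (hvg : v ∈ g)
    (hL : ∀ z ∈ E, ¬z.IsDiag) (hR : ∀ z ∈ E, v ∉ z → z ∈ R₀)
    (hrr : ∀ y, s(v, y) ∈ E → y ≠ u → s(u, y) ∈ R₀)
    (hcard : (E.filter (fun z => v ∈ z)).card ≤ n + 1 + 1) :
    (∀ z ∈ E', ¬z.IsDiag) ∧ (∀ z ∈ E', v ∉ z → z ∈ R₀) ∧
    (∀ y, s(v, y) ∈ E' → y ≠ u → s(u, y) ∈ R₀) ∧
    (E'.filter (fun z => v ∈ z)).card ≤ n + 1 := by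
  refine ⟨?_, ?_, ?_, ?_⟩
  · intro z hz
    rcases Finset.mem_insert.1 (hsub hz) with rfl | hz'
    · exact hg'd
    · exact hL z hz'
  · intro z hz hvz
    rcases Finset.mem_insert.1 (hsub hz) with rfl | hz'
    · exact hg'R
    · exact hR z hz' hvz
  · intro y hy hyu
    rcases Finset.mem_insert.1 (hsub hy) with hy' | hy'
    · exact absurd (hy' ▸ Sym2.mem_mk_left v y) hvg'
    · exact hrr y hy' hyu
  · have hss : E'.filter (fun z => v ∈ z) ⊆ (E.filter (fun z => v ∈ z)).erase g := by
      intro z hz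
      rw [Finset.mem_filter] at hz
      rw [Finset.mem_erase, Finset.mem_filter]
      refine ⟨fun h => hgE' (h ▸ hz.1), ?_, hz.2⟩
      rcases Finset.mem_insert.1 (hsub hz.1) with rfl | hz'
      · exact absurd hz.2 hvg'
      · exact hz'
    have := Finset.card_le_card hss
    rw [Finset.card_erase_of_mem (Finset.mem_filter.2 ⟨hgE, hvg⟩)] at this
    omega

/-- A triangle `u v x` inside the pinned set `K ∪ {e,f}` makes `(R)` trivial. [elementary] -/
theorem lsm_of_pinned_triangle (w : Sym2 V → ℝ) (hw : ∀ x, 0 ≤ w x) (D K : Finset (Sym2 V))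
    (e f : Sym2 V) (hL : ∀ z ∈ D ∪ insert e (insert f K), ¬z.IsDiag) {u v x : V} (huv : u ≠ v)
    (hvx : v ≠ x) (hux : u ≠ x) (h₁ : s(v, u) ∈ insert e (insert f K))
    (h₂ : s(v, x) ∈ insert e (insert f K)) (h₃ : s(u, x) ∈ insert e (insert f K)) :
    (∑ G ∈ D.powerset.filter (fun G =>
        (fromEdgeSet ((G ∪ (insert e (insert f (K))) : Finset (Sym2 V)) : Set (Sym2 V))).IsAcyclic), ∏ y ∈ G, w y) *
      (∑ G ∈ D.powerset.filter (fun G =>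
        (fromEdgeSet ((G ∪ (K) : Finset (Sym2 V)) : Set (Sym2 V))).IsAcyclic), ∏ y ∈ G, w y) ≤
    (∑ G ∈ D.powerset.filter (fun G =>
        (fromEdgeSet ((G ∪ (insert e (K)) : Finset (Sym2 V)) : Set (Sym2 V))).IsAcyclic), ∏ y ∈ G, w y) *
      (∑ G ∈ D.powerset.filter (fun G =>
        (fromEdgeSet ((G ∪ (insert f (K)) : Finset (Sym2 V)) : Set (Sym2 V))).IsAcyclic), ∏ y ∈ G, w y) :=
  lsm_of_not_isAcyclic_pin w hw D K e f (not_isAcyclic_of_triangle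
    (fun z hz => hL z (Finset.mem_union_right _ hz)) (a := u) (b := v) (c := x)
    (by rw [Sym2.eq_swap]; exact h₁) h₂ h₃ huv hvx hux)

/-- **Base of the contraction: only `uv` is left at `v`.** [elementary; `lsm_pin_pendant` + `R₀`] -/
theorem lsm_contract_base (R₀ : Finset (Sym2 V))
    (hR₀ : ∀ (w : Sym2 V → ℝ), (∀ x, 0 ≤ w x) → ∀ (D K : Finset (Sym2 V)) (e f : Sym2 V),
      D ∪ insert e (insert f K) ⊆ R₀ → Disjoint D K → e ∉ D → e ∉ K → f ∉ D →
      f ∉ K → e ≠ f →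
      (∑ G ∈ D.powerset.filter (fun G =>
        (fromEdgeSet ((G ∪ (insert e (insert f (K))) : Finset (Sym2 V)) : Set (Sym2 V))).IsAcyclic), ∏ y ∈ G, w y) *
        (∑ G ∈ D.powerset.filter (fun G =>
        (fromEdgeSet ((G ∪ (K) : Finset (Sym2 V)) : Set (Sym2 V))).IsAcyclic), ∏ y ∈ G, w y) ≤
      (∑ G ∈ D.powerset.filter (fun G =>
        (fromEdgeSet ((G ∪ (insert e (K)) : Finset (Sym2 V)) : Set (Sym2 V))).IsAcyclic), ∏ y ∈ G, w y) *
        (∑ G ∈ D.powerset.filter (fun G =>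
        (fromEdgeSet ((G ∪ (insert f (K)) : Finset (Sym2 V)) : Set (Sym2 V))).IsAcyclic), ∏ y ∈ G, w y))
    (u v : V) (huv : u ≠ v) (w : Sym2 V → ℝ) (hw : ∀ x, 0 ≤ w x) (D K : Finset (Sym2 V)) (e f : Sym2 V)
    (hDK : Disjoint D K) (heD : e ∉ D) (heK : e ∉ K) (hfD : f ∉ D) (hfK : f ∉ K) (hef : e ≠ f)
    (huvK : s(v, u) ∈ K) (hL : ∀ z ∈ D ∪ insert e (insert f K), ¬z.IsDiag)
    (hR : ∀ z ∈ D ∪ insert e (insert f K), v ∉ z → z ∈ R₀)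
    (honly : ∀ z ∈ D ∪ insert e (insert f K), v ∈ z → z = s(v, u)) :
    (∑ G ∈ D.powerset.filter (fun G =>
        (fromEdgeSet ((G ∪ (insert e (insert f (K))) : Finset (Sym2 V)) : Set (Sym2 V))).IsAcyclic), ∏ y ∈ G, w y) *
      (∑ G ∈ D.powerset.filter (fun G =>
        (fromEdgeSet ((G ∪ (K) : Finset (Sym2 V)) : Set (Sym2 V))).IsAcyclic), ∏ y ∈ G, w y) ≤
    (∑ G ∈ D.powerset.filter (fun G =>
        (fromEdgeSet ((G ∪ (insert e (K)) : Finset (Sym2 V)) : Set (Sym2 V))).IsAcyclic), ∏ y ∈ G, w y) *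
      (∑ G ∈ D.powerset.filter (fun G =>
        (fromEdgeSet ((G ∪ (insert f (K)) : Finset (Sym2 V)) : Set (Sym2 V))).IsAcyclic), ∏ y ∈ G, w y) := by
  have huvD : s(v, u) ∉ D := fun h => Finset.disjoint_left.1 hDK h huvK
  have huve : s(v, u) ≠ e := fun h => heK (h ▸ huvK)
  have huvf : s(v, u) ≠ f := fun h => hfK (h ▸ huvK)
  have hsub₀ : D ∪ insert e (insert f (K.erase s(v, u))) ⊆ D ∪ insert e (insert f K) :=
    Finset.union_subset_union subset_rfl (Finset.insert_subset_insert e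
      (Finset.insert_subset_insert f (Finset.erase_subset _ _)))
  have hv : ∀ z ∈ D ∪ insert e (insert f (K.erase s(v, u))), v ∉ z := by
    intro z hz hvz
    have hz' := honly z (hsub₀ hz) hvz
    subst hz'
    simp only [Finset.mem_union, Finset.mem_insert, Finset.mem_erase] at hz
    rcases hz with h | h | h | h
    · exact huvD h
    · exact huve h
    · exact huvf h
    · exact h.1 rfl
  have hin : D ∪ insert e (insert f (K.erase s(v, u))) ⊆ R₀ := fun z hz => hR z (hsub₀ hz) (hv z hz)
  rw [show K = insert s(v, u) (K.erase s(v, u)) from (Finset.insert_erase huvK).symm]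
  exact lsm_pin_pendant w D (K.erase s(v, u)) e f (fun z hz => hL z (hsub₀ hz)) hv huv
    (hR₀ w hw D (K.erase s(v, u)) e f hin (Finset.disjoint_of_subset_right (Finset.erase_subset _ _) hDK)
      heD (fun h => heK (Finset.mem_of_mem_erase h)) hfD (fun h => hfK (Finset.mem_of_mem_erase h)) hef)

/-- **Contraction step, `vx` pinned.** [cases: `ux` pinned / Rayleigh ⇒ trivial; `ux` free ⇒ dropped;
then `vx` is re-pinned as `ux`] -/
theorem lsm_contract_step_pin (R₀ : Finset (Sym2 V)) (u v : V) (huv : u ≠ v) (n : ℕ)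
    (ih : ∀ (w : Sym2 V → ℝ), (∀ x, 0 ≤ w x) → ∀ (D K : Finset (Sym2 V)) (e f : Sym2 V),
        Disjoint D K → e ∉ D → e ∉ K → f ∉ D → f ∉ K → e ≠ f → s(v, u) ∈ K →
        (∀ z ∈ D ∪ insert e (insert f K), ¬z.IsDiag) →
        (∀ z ∈ D ∪ insert e (insert f K), v ∉ z → z ∈ R₀) →
        (∀ y, s(v, y) ∈ D ∪ insert e (insert f K) → y ≠ u → s(u, y) ∈ R₀) →
        ((D ∪ insert e (insert f K)).filter (fun z => v ∈ z)).card ≤ n + 1 →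
        (∑ G ∈ D.powerset.filter (fun G =>
        (fromEdgeSet ((G ∪ (insert e (insert f (K))) : Finset (Sym2 V)) : Set (Sym2 V))).IsAcyclic), ∏ y ∈ G, w y) *
          (∑ G ∈ D.powerset.filter (fun G =>
        (fromEdgeSet ((G ∪ (K) : Finset (Sym2 V)) : Set (Sym2 V))).IsAcyclic), ∏ y ∈ G, w y) ≤
        (∑ G ∈ D.powerset.filter (fun G =>
        (fromEdgeSet ((G ∪ (insert e (K)) : Finset (Sym2 V)) : Set (Sym2 V))).IsAcyclic), ∏ y ∈ G, w y) *
          (∑ G ∈ D.powerset.filter (fun G =>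
        (fromEdgeSet ((G ∪ (insert f (K)) : Finset (Sym2 V)) : Set (Sym2 V))).IsAcyclic), ∏ y ∈ G, w y))
    (w : Sym2 V → ℝ) (hw : ∀ x, 0 ≤ w x) (D K : Finset (Sym2 V)) (e f : Sym2 V)
    (hDK : Disjoint D K) (heD : e ∉ D) (heK : e ∉ K) (hfD : f ∉ D) (hfK : f ∉ K) (hef : e ≠ f)
    (huvK : s(v, u) ∈ K) (hL : ∀ z ∈ D ∪ insert e (insert f K), ¬z.IsDiag)
    (hR : ∀ z ∈ D ∪ insert e (insert f K), v ∉ z → z ∈ R₀)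
    (hrr : ∀ y, s(v, y) ∈ D ∪ insert e (insert f K) → y ≠ u → s(u, y) ∈ R₀)
    (hcard : ((D ∪ insert e (insert f K)).filter (fun z => v ∈ z)).card ≤ n + 1 + 1)
    {x : V} (hxu : x ≠ u) (hxv : v ≠ x)
    (hgK : s(v, x) ∈ K) :
    (∑ G ∈ D.powerset.filter (fun G =>
        (fromEdgeSet ((G ∪ (insert e (insert f (K))) : Finset (Sym2 V)) : Set (Sym2 V))).IsAcyclic), ∏ y ∈ G, w y) *
      (∑ G ∈ D.powerset.filter (fun G =>
        (fromEdgeSet ((G ∪ (K) : Finset (Sym2 V)) : Set (Sym2 V))).IsAcyclic), ∏ y ∈ G, w y) ≤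
    (∑ G ∈ D.powerset.filter (fun G =>
        (fromEdgeSet ((G ∪ (insert e (K)) : Finset (Sym2 V)) : Set (Sym2 V))).IsAcyclic), ∏ y ∈ G, w y) *
      (∑ G ∈ D.powerset.filter (fun G =>
        (fromEdgeSet ((G ∪ (insert f (K)) : Finset (Sym2 V)) : Set (Sym2 V))).IsAcyclic), ∏ y ∈ G, w y) := by
  have hux : u ≠ x := fun h => hxu h.symm
  have hvu : v ≠ u := fun h => huv h.symm
  have hg'd : ¬(s(u, x)).IsDiag := fun h => hux (Sym2.mk_isDiag_iff.1 h)
  have hvg' : v ∉ s(u, x) := by rw [Sym2.mem_iff, not_or]; exact ⟨hvu, hxv⟩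
  have hvg : v ∈ s(v, x) := Sym2.mem_mk_left _ _
  have hgE : s(v, x) ∈ D ∪ insert e (insert f K) := by simp [hgK]
  have hg'R : s(u, x) ∈ R₀ := hrr x hgE hxu
  have hne : s(v, x) ≠ s(u, x) := fun h => hvg' (h ▸ hvg)
  have hguv : s(v, x) ≠ s(v, u) := fun h => hxu (Sym2.congr_right.1 h)
  have hgD : s(v, x) ∉ D := fun h => Finset.disjoint_left.1 hDK h hgK
  have hge : s(v, x) ≠ e := fun h => heK (h ▸ hgK)
  have hgf : s(v, x) ≠ f := fun h => hfK (h ▸ hgK)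
  -- trivial cases: `ux` pinned or a Rayleigh edge
  by_cases h'K : s(u, x) ∈ K
  · exact lsm_of_pinned_triangle w hw D K e f hL huv hxv hux (by simp [huvK]) (by simp [hgK]) (by simp [h'K])
  by_cases h'e : s(u, x) = e
  · exact lsm_of_pinned_triangle w hw D K e f hL huv hxv hux (by simp [huvK]) (by simp [hgK]) (by simp [h'e])
  by_cases h'f : s(u, x) = f
  · exact lsm_of_pinned_triangle w hw D K e f hL huv hxv hux (by simp [huvK]) (by simp [hgK]) (by simp [h'f])
  -- the re-pinning argument, for any free set `D' ⊆ D` avoiding `ux`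
  have core : ∀ D' : Finset (Sym2 V), D' ⊆ D → s(u, x) ∉ D' →
      (∑ G ∈ D'.powerset.filter (fun G =>
        (fromEdgeSet ((G ∪ (insert e (insert f (K))) : Finset (Sym2 V)) : Set (Sym2 V))).IsAcyclic), ∏ y ∈ G, w y) *
        (∑ G ∈ D'.powerset.filter (fun G =>
        (fromEdgeSet ((G ∪ (K) : Finset (Sym2 V)) : Set (Sym2 V))).IsAcyclic), ∏ y ∈ G, w y) ≤
      (∑ G ∈ D'.powerset.filter (fun G =>
        (fromEdgeSet ((G ∪ (insert e (K)) : Finset (Sym2 V)) : Set (Sym2 V))).IsAcyclic), ∏ y ∈ G, w y) *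
        (∑ G ∈ D'.powerset.filter (fun G =>
        (fromEdgeSet ((G ∪ (insert f (K)) : Finset (Sym2 V)) : Set (Sym2 V))).IsAcyclic), ∏ y ∈ G, w y) := by
    intro D' hD'D h'D'
    have hDK' : Disjoint D' K := Finset.disjoint_of_subset_left hD'D hDK
    have hsubE : D' ∪ insert e (insert f K) ⊆ D ∪ insert e (insert f K) :=
      Finset.union_subset_union hD'D subset_rfl
    set K₁ := K.erase s(v, x) with hK₁
    have hKeq : K = insert s(v, x) K₁ := (Finset.insert_erase hgK).symm
    have huvK₁ : s(v, u) ∈ K₁ := Finset.mem_erase.2 ⟨hguv.symm, huvK⟩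
    have hfresh : s(u, x) ∉ D' ∪ insert e (insert f K₁) := by
      simp only [Finset.mem_union, Finset.mem_insert, hK₁, Finset.mem_erase, not_or]
      exact ⟨h'D', h'e, h'f, fun h => h'K h.2⟩
    have hgfresh : s(v, x) ∉ D' ∪ insert e (insert f K₁) := by
      simp only [Finset.mem_union, Finset.mem_insert, hK₁, Finset.mem_erase, not_or]
      exact ⟨fun h => hgD (hD'D h), hge, hgf, fun h => h.1 rfl⟩
    have hL₁ : ∀ z ∈ D' ∪ insert e (insert f K₁), ¬z.IsDiag := fun z hz => hL z (hsubE (by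
      simp only [Finset.mem_union, Finset.mem_insert, hK₁, Finset.mem_erase] at hz ⊢; tauto))
    -- the new instance `(D'; K₁ ∪ ux; e, f)`
    have hsub' : D' ∪ insert e (insert f (insert s(u, x) K₁)) ⊆ insert s(u, x) (D ∪ insert e (insert f K)) := by
      intro z hz
      simp only [Finset.mem_union, Finset.mem_insert, hK₁, Finset.mem_erase] at hz ⊢
      rcases hz with h | h | h | h | h
      · exact Or.inr (Or.inl (hD'D h))
      · exact Or.inr (Or.inr (Or.inl h))
      · exact Or.inr (Or.inr (Or.inr (Or.inl h)))
      · exact Or.inl h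
      · exact Or.inr (Or.inr (Or.inr (Or.inr h.2)))
    have hgE' : s(v, x) ∉ D' ∪ insert e (insert f (insert s(u, x) K₁)) := by
      simp only [Finset.mem_union, Finset.mem_insert, hK₁, Finset.mem_erase, not_or]
      exact ⟨fun h => hgD (hD'D h), hge, hgf, hne, fun h => h.1 rfl⟩
    obtain ⟨hL', hR', hrr', hcard'⟩ := contract_transfer hsub' hg'R hg'd hvg' hgE hgE' hvg hL hR hrr hcard
    rw [hKeq]
    refine lsm_pin_reroute w D' K₁ e f hL₁ huvK₁ hxv hux hgfresh hfresh ?_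
    exact ih w hw D' (insert s(u, x) K₁) e f
      (Finset.disjoint_insert_right.2 ⟨h'D', Finset.disjoint_of_subset_right (Finset.erase_subset _ _) hDK'⟩)
      (fun h => heD (hD'D h)) (by rw [Finset.mem_insert, not_or]; exact ⟨fun h => h'e h.symm, fun h => heK (Finset.mem_of_mem_erase h)⟩)
      (fun h => hfD (hD'D h)) (by rw [Finset.mem_insert, not_or]; exact ⟨fun h => h'f h.symm, fun h => hfK (Finset.mem_of_mem_erase h)⟩)
      hef (Finset.mem_insert_of_mem huvK₁) hL' hR' hrr' hcard'
  by_cases h'D : s(u, x) ∈ D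
  · -- `ux` free closes the pinned path `x v u`: drop it first
    rw [show D = insert s(u, x) (D.erase s(u, x)) from (Finset.insert_erase h'D).symm]
    refine lsm_free_closing w (D.erase s(u, x)) K e f s(u, x) (Finset.notMem_erase _ _) ?_
      (core _ (Finset.erase_subset _ _) (Finset.notMem_erase _ _))
    exact not_isAcyclic_of_triangle (X := insert s(u, x) K) (a := u) (b := v) (c := x)
      (by
        intro z hz
        rcases Finset.mem_insert.1 hz with rfl | hz
        · exact hg'd
        · exact hL z (by simp [hz]))
      (Finset.mem_insert_of_mem (by rw [Sym2.eq_swap]; exact huvK)) (Finset.mem_insert_of_mem hgK)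
      (Finset.mem_insert_self _ _) huv hxv hux
  · exact core D subset_rfl h'D

end Summit.CriticalPhenomena.PercolationContinuityZ3.Theorems.ForestRayleigh
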